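import Literature.AlgebraicGeometry.Frobenioids.QuasiTemperoidConnected
import Mathlib.CategoryTheory.Adjunction.Restrict
import HarnessLib

/-!
# Frobenioids II, Example 1.3 (ii): the functor `φ_* : B^temp(Π₁)⁰ → B^temp(Π₂)⁰` and its adjunction

Mochizuki, *The geometry of Frobenioids II*, Kyushu J. Math. **62** (2008) 401–460, §1 Example 1.3
(ii), author's text p. 11 [cite: MochizukiFrdII2008, Ex 1.3 (ii) p.11]: for an open homomorphism
`φ : Π₁ → Π₂` of tempered groups "observe that `φ` induces a natural functor
`φ_* : B^temp(Π₁)⁰ → B^temp(Π₂)⁰` … obtained by mapping a `Π₁`-set `E` to the `φ(Π₁)`-set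
`E' := E/Ker(φ)` given by taking the set of `Ker(φ)`-orbits of `E`. When `φ` is surjective, one verifies
immediately that the functor `φ_*` is left adjoint to the pull-back functor `B^temp(Π₂)⁰ → B^temp(Π₁)⁰`."

This file CONSTRUCTS `φ_*` for a surjective open homomorphism and PROVES the adjunction, discharging the
named fact `QuasiTemperoid.PushforwardFunctor` of `QuasiTemperoid.lean` (seat abc-iut-L1-t4) with the
printed functor as witness: `OrbitSet φ X` = `E/Ker(φ)`; `orbitMulAction` = the `Π₂ (= Π₁/Ker φ)`-action
`φ(g₁) · [x] = [g₁ · x]` (written through a set-theoretic section of `φ`, of which it is independent,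
`orbit_smul_mk`); `orbitObj φ … X ∈ Ob(B^temp(Π₂))` (countable; the stabiliser of `[x]` is the image under
the OPEN map `φ` of the open set `⋃_{k ∈ Ker φ} k · Stab(x)`); the functor `orbits : BTemp Π₁ ⥤ BTemp Π₂`
and `orbitsAdjunction : orbits ⊣ BTemp.res φ` (a `Π₁`-map to a pulled-back `Π₂`-set is constant on
`Ker(φ)`-orbits); their restrictions `pushforward` / `pullback` to the connected objects (single orbits go
to single orbits both ways), `pushforwardAdjunction`, and `pushforwardFunctor_holds`. Temperedness of
`Π₁`, `Π₂` is not needed for the construction; surjectivity is what makes `Π₂` act on `E/Ker(φ)`. The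
general (non-surjective) `φ_*` of the text ("orbits, then induction from the open subgroup `φ(Π₁)`") is
the companion `QuasiTemperoidInduction.lean`. No statement of the paper is strengthened.
-/

open CategoryTheory CategoryTheory.Limits Topology
open Literature.AnabelianGeometry.SemiGraphs

namespace Literature.AlgebraicGeometry.Frobenioids

namespace QuasiTemperoid

universe u

variable {G₁ : Type u} [Group G₁] [TopologicalSpace G₁] {G₂ : Type u} [Group G₂]

/-! ### The orbit set `E/Ker(φ)` -/

section OrbitSet

variable (φ : G₁ →* G₂)

/-- The `Ker(φ)`-orbit relation on the `Π₁`-set `E` underlying `X ∈ Ob(B^temp(Π₁))`: `x ~ y` iff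
`y = k · x` for some `k ∈ Ker(φ)` (FrdII Ex. 1.3 (ii), p. 11: "the set of `Ker(φ)`-orbits of `E`").
[cite: MochizukiFrdII2008, Ex 1.3 (ii) p.11] -/
def kerRel (X : BTemp G₁) : Setoid X.obj.V where
  r x y := ∃ k : G₁, φ k = 1 ∧ X.obj.ρ k x = y
  iseqv :=
    { refl := fun x => ⟨1, map_one φ, BTempConnected.ρ_one_apply X x⟩
      symm := fun {x y} ⟨k, hk, h⟩ => ⟨k⁻¹, by rw [map_inv, hk, inv_one], by
        rw [← h, BTempConnected.ρ_inv_apply]⟩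
      trans := fun {x y z} ⟨k, hk, h⟩ ⟨k', hk', h'⟩ => ⟨k' * k, by rw [map_mul, hk, hk', one_mul], by
        rw [BTempConnected.ρ_mul_apply, h, h']⟩ }

/-- `E' := E/Ker(φ)`, the set of `Ker(φ)`-orbits of the `Π₁`-set `E` underlying `X` (FrdII Ex. 1.3 (ii),
p. 11). [cite: MochizukiFrdII2008, Ex 1.3 (ii) p.11] -/
def OrbitSet (X : BTemp G₁) : Type u := Quotient (kerRel φ X)

variable {φ}

/-- The `Ker(φ)`-orbit relation, unfolded. [cite: MochizukiFrdII2008, Ex 1.3 (ii) p.11] -/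
theorem kerRel_iff {X : BTemp G₁} {x y : X.obj.V} :
    (kerRel φ X) x y ↔ ∃ k : G₁, φ k = 1 ∧ X.obj.ρ k x = y :=
  Iff.rfl

/-- The class `[x] ∈ E/Ker(φ)` of a point. [cite: MochizukiFrdII2008, Ex 1.3 (ii) p.11] -/
def orbitMk {X : BTemp G₁} (x : X.obj.V) : OrbitSet φ X := Quotient.mk (kerRel φ X) x

/-- Two points have the same class in `E/Ker(φ)` iff they differ by an element of `Ker(φ)`.
[cite: MochizukiFrdII2008, Ex 1.3 (ii) p.11] -/
theorem orbitMk_eq_iff {X : BTemp G₁} {x y : X.obj.V} :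
    (orbitMk x : OrbitSet φ X) = orbitMk y ↔ ∃ k : G₁, φ k = 1 ∧ X.obj.ρ k x = y :=
  Quotient.eq

/-- Every class has a representative. [cite: MochizukiFrdII2008, Ex 1.3 (ii) p.11] -/
theorem orbitMk_surjective (X : BTemp G₁) : Function.Surjective (orbitMk : X.obj.V → OrbitSet φ X) :=
  Quotient.mk_surjective

/-- `E/Ker(φ)` is countable since `E` is. [cite: MochizukiFrdII2008, Ex 1.3 (ii) p.11] -/
theorem countable_orbitSet (X : BTemp G₁) : Countable (OrbitSet φ X) := by
  haveI : Countable X.obj.V := X.property.1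
  exact inferInstanceAs (Countable (Quotient (kerRel φ X)))

variable (φ) in
/-- A `Π₁`-map `E → F` descends to the orbit sets `E/Ker(φ) → F/Ker(φ)`.
[cite: MochizukiFrdII2008, Ex 1.3 (ii) p.11] -/
def orbitMap {X Y : BTemp G₁} (f : X ⟶ Y) : OrbitSet φ X → OrbitSet φ Y :=
  Quotient.map' (fun x => (f.hom.hom x : Y.obj.V)) fun x y hxy => by
    obtain ⟨k, hk, h⟩ := kerRel_iff.1 hxy
    exact kerRel_iff.2 ⟨k, hk, by rw [← BTempConnected.hom_ρ, h]⟩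

/-- The descended map on classes: `[x] ↦ [f x]`. [cite: MochizukiFrdII2008, Ex 1.3 (ii) p.11] -/
theorem orbitMap_mk {X Y : BTemp G₁} (f : X ⟶ Y) (x : X.obj.V) :
    orbitMap φ f (orbitMk x) = (orbitMk (f.hom.hom x) : OrbitSet φ Y) :=
  rfl

end OrbitSet

/-! ### The `Π₂`-action on `E/Ker(φ)` for surjective `φ` -/

section Action

variable (φ : G₁ →* G₂) (hs : Function.Surjective φ)

/-- For surjective `φ`, the group `Π₂ = Π₁/Ker(φ)` acts on `E/Ker(φ)` by `φ(g₁) · [x] := [g₁ · x]`;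
written with a set-theoretic section `σ` of `φ` as `g₂ · [x] := [σ(g₂) · x]` (independent of `σ`, see
`orbit_smul_mk`). This is the `φ(Π₁)`-set structure on `E'` of FrdII Ex. 1.3 (ii), p. 11.
[cite: MochizukiFrdII2008, Ex 1.3 (ii) p.11] -/
@[reducible] noncomputable def orbitMulAction (X : BTemp G₁) : MulAction G₂ (OrbitSet φ X) where
  smul g₂ := Quotient.map' (fun x => X.obj.ρ (Function.surjInv hs g₂) x) fun x y hxy => by
    obtain ⟨k, hk, h⟩ := kerRel_iff.1 hxy
    refine kerRel_iff.2 ⟨Function.surjInv hs g₂ * k * (Function.surjInv hs g₂)⁻¹, ?_, ?_⟩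
    · rw [map_mul, map_mul, hk, mul_one, ← map_mul, mul_inv_cancel, map_one]
    · rw [← h, BTempConnected.ρ_mul_apply, BTempConnected.ρ_mul_apply, BTempConnected.ρ_inv_apply]
  one_smul q := by
    induction q using Quotient.ind with
    | _ x =>
      change Quotient.mk _ (X.obj.ρ (Function.surjInv hs 1) x) = Quotient.mk _ x
      apply Quotient.sound
      refine ⟨(Function.surjInv hs 1)⁻¹, ?_, ?_⟩
      · rw [map_inv, Function.surjInv_eq hs, inv_one]
      · rw [BTempConnected.ρ_inv_apply]
  mul_smul g h q := by
    induction q using Quotient.ind with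
    | _ x =>
      change Quotient.mk _ (X.obj.ρ (Function.surjInv hs (g * h)) x) =
        Quotient.mk _ (X.obj.ρ (Function.surjInv hs g) (X.obj.ρ (Function.surjInv hs h) x))
      apply Quotient.sound
      refine ⟨Function.surjInv hs g * Function.surjInv hs h * (Function.surjInv hs (g * h))⁻¹, ?_, ?_⟩
      · rw [map_mul, map_mul, map_inv, Function.surjInv_eq hs, Function.surjInv_eq hs,
          Function.surjInv_eq hs, mul_inv_cancel]
      · rw [BTempConnected.ρ_mul_apply, BTempConnected.ρ_inv_apply, BTempConnected.ρ_mul_apply]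

/-- The action on classes, through the chosen section. [cite: MochizukiFrdII2008, Ex 1.3 (ii) p.11] -/
theorem orbit_smul_def (X : BTemp G₁) (g₂ : G₂) (x : X.obj.V) :
    (letI := orbitMulAction φ hs X; g₂ • (orbitMk x : OrbitSet φ X)) =
      orbitMk (X.obj.ρ (Function.surjInv hs g₂) x) :=
  rfl

/-- The defining formula `φ(g₁) · [x] = [g₁ · x]` of the `Π₂`-action on `E/Ker(φ)` (independence of the
section). [cite: MochizukiFrdII2008, Ex 1.3 (ii) p.11] -/
theorem orbit_smul_mk (X : BTemp G₁) (g₁ : G₁) (x : X.obj.V) :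
    (letI := orbitMulAction φ hs X; φ g₁ • (orbitMk x : OrbitSet φ X)) = orbitMk (X.obj.ρ g₁ x) := by
  rw [orbit_smul_def, orbitMk_eq_iff]
  refine ⟨g₁ * (Function.surjInv hs (φ g₁))⁻¹, ?_, ?_⟩
  · rw [map_mul, map_inv, Function.surjInv_eq hs, mul_inv_cancel]
  · rw [BTempConnected.ρ_mul_apply, BTempConnected.ρ_inv_apply]

/-- The stabiliser in `Π₁` of a class `[x]` is the open set `⋃_{k ∈ Ker(φ)} k · Stab(x)`.
[cite: MochizukiFrdII2008, Ex 1.3 (ii) p.11] -/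
theorem isOpen_setOf_orbitMk_eq [IsTopologicalGroup G₁] (X : BTemp G₁) (x : X.obj.V) :
    IsOpen {g₁ : G₁ | (orbitMk (X.obj.ρ g₁ x) : OrbitSet φ X) = orbitMk x} := by
  have : {g₁ : G₁ | (orbitMk (X.obj.ρ g₁ x) : OrbitSet φ X) = orbitMk x} =
      ⋃ k ∈ {k : G₁ | φ k = 1}, (fun g => k * g) ⁻¹' {g : G₁ | X.obj.ρ g x = x} := by
    ext g₁
    simp only [Set.mem_setOf_eq, Set.mem_iUnion, Set.mem_preimage, orbitMk_eq_iff, exists_prop]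
    refine ⟨fun ⟨k, hk, h⟩ => ⟨k, hk, ?_⟩, fun ⟨k, hk, h⟩ => ⟨k, hk, ?_⟩⟩
    · rwa [BTempConnected.ρ_mul_apply]
    · rwa [BTempConnected.ρ_mul_apply] at h
  rw [this]
  exact isOpen_biUnion fun k _ => (X.property.2 x).preimage (continuous_const.mul continuous_id)

variable [TopologicalSpace G₂]

/-- `φ_*(X) := E/Ker(φ)` with its `Π₂`-action is an object of `B^temp(Π₂)`: it is countable, and the
stabiliser of `[x]` is the image under the open map `φ` of the open set `⋃_{k ∈ Ker(φ)} k · Stab(x)`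
(FrdII Ex. 1.3 (ii), p. 11). [cite: MochizukiFrdII2008, Ex 1.3 (ii) p.11] -/
noncomputable def orbitObj [IsTopologicalGroup G₁] (hφ : IsOpenMap φ) (X : BTemp G₁) : BTemp G₂ :=
  ⟨@Action.ofMulAction G₂ (OrbitSet φ X) _ (orbitMulAction φ hs X), by
    letI := orbitMulAction φ hs X
    refine ⟨countable_orbitSet X, fun q => ?_⟩
    induction q using Quotient.ind with
    | _ x =>
      have : {g₂ : G₂ | (Action.ofMulAction G₂ (OrbitSet φ X)).ρ g₂ (Quotient.mk _ x) = Quotient.mk _ x} =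
          φ '' {g₁ : G₁ | (orbitMk (X.obj.ρ g₁ x) : OrbitSet φ X) = orbitMk x} := by
        ext g₂
        simp only [Set.mem_setOf_eq, Set.mem_image]
        change g₂ • (orbitMk x : OrbitSet φ X) = orbitMk x ↔ _
        constructor
        · intro h
          refine ⟨Function.surjInv hs g₂, ?_, Function.surjInv_eq hs g₂⟩
          rwa [orbit_smul_def] at h
        · rintro ⟨g₁, hg₁, rfl⟩
          rwa [orbit_smul_mk]
      rw [this]
      exact hφ _ (isOpen_setOf_orbitMk_eq φ X x)⟩

/-- The action of `φ_*(X)` on classes of points: `φ(g₁) · [x] = [g₁ · x]`.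
[cite: MochizukiFrdII2008, Ex 1.3 (ii) p.11] -/
theorem orbitObj_ρ_mk [IsTopologicalGroup G₁] (hφ : IsOpenMap φ) (X : BTemp G₁) (g₁ : G₁) (x : X.obj.V) :
    (orbitObj φ hs hφ X).obj.ρ (φ g₁) (orbitMk x) = (orbitMk (X.obj.ρ g₁ x) : OrbitSet φ X) :=
  orbit_smul_mk φ hs X g₁ x

/-- The action of `φ_*(X)` through the section: `g₂ · [x] = [σ(g₂) · x]`.
[cite: MochizukiFrdII2008, Ex 1.3 (ii) p.11] -/
theorem orbitObj_ρ_mk' [IsTopologicalGroup G₁] (hφ : IsOpenMap φ) (X : BTemp G₁) (g₂ : G₂) (x : X.obj.V) :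
    (orbitObj φ hs hφ X).obj.ρ g₂ (orbitMk x) =
      (orbitMk (X.obj.ρ (Function.surjInv hs g₂) x) : OrbitSet φ X) :=
  rfl

end Action

/-! ### The functor `E ↦ E/Ker(φ)` and its adjunction to the pull-back functor -/

section Lift

variable [TopologicalSpace G₂] (φ : G₁ →* G₂) (hc : Continuous φ)

/-- A `Π₁`-map `E → F|_{Π₁}` to a pulled-back `Π₂`-set is constant on `Ker(φ)`-orbits (`Ker(φ)` acts
trivially on `F|_{Π₁}`), hence descends to `E/Ker(φ) → F`. [cite: MochizukiFrdII2008, Ex 1.3 (ii) p.11] -/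
def orbitLift {X : BTemp G₁} {Y : BTemp G₂} (v : X ⟶ (BTemp.res ⟨φ, hc⟩).obj Y) : OrbitSet φ X → Y.obj.V :=
  Quotient.lift (fun x => (v.hom.hom x : Y.obj.V)) fun x y hxy => by
    obtain ⟨k, hk, rfl⟩ := kerRel_iff.1 hxy
    have e := BTempConnected.hom_ρ v k x
    change (v.hom.hom (X.obj.ρ k x) : Y.obj.V) = Y.obj.ρ (φ k) (v.hom.hom x) at e
    rw [e, hk, BTempConnected.ρ_one_apply]

/-- The descended map on classes: `[x] ↦ v x`. [cite: MochizukiFrdII2008, Ex 1.3 (ii) p.11] -/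
theorem orbitLift_mk {X : BTemp G₁} {Y : BTemp G₂} (v : X ⟶ (BTemp.res ⟨φ, hc⟩).obj Y) (x : X.obj.V) :
    orbitLift φ hc v (orbitMk x) = (v.hom.hom x : Y.obj.V) :=
  rfl

end Lift

section Functor

variable [TopologicalSpace G₂] [IsTopologicalGroup G₁] (φ : G₁ →* G₂) (hs : Function.Surjective φ)
  (hφ : IsOpenMap φ)

/-- The functor `B^temp(Π₁) → B^temp(Π₂)`, `E ↦ E/Ker(φ)`, on all of `B^temp(Π₁)` (FrdII Ex. 1.3 (ii),
p. 11); a `Π₁`-map descends to the orbit sets. [cite: MochizukiFrdII2008, Ex 1.3 (ii) p.11] -/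
noncomputable def orbits : BTemp G₁ ⥤ BTemp G₂ where
  obj X := orbitObj φ hs hφ X
  map {X Y} f := ObjectProperty.homMk
    { hom := TypeCat.ofHom (orbitMap φ f)
      comm := fun g₂ => by
        apply ConcreteCategory.hom_ext
        intro q
        induction q using Quotient.ind with
        | _ x =>
          change orbitMap φ f ((orbitObj φ hs hφ X).obj.ρ g₂ (orbitMk x)) =
            (orbitObj φ hs hφ Y).obj.ρ g₂ (orbitMap φ f (orbitMk x))
          rw [orbitObj_ρ_mk', orbitMap_mk, orbitMap_mk, orbitObj_ρ_mk', BTempConnected.hom_ρ] }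
  map_id X := by
    apply BTempConnected.hom_ext_apply
    intro q
    induction q using Quotient.ind with
    | _ x => rfl
  map_comp f g := by
    apply BTempConnected.hom_ext_apply
    intro q
    induction q using Quotient.ind with
    | _ x => rfl

/-- `φ_*` on classes of points: `φ_*(f)[x] = [f x]`. [cite: MochizukiFrdII2008, Ex 1.3 (ii) p.11] -/
theorem orbits_map_mk {X Y : BTemp G₁} (f : X ⟶ Y) (x : X.obj.V) :
    (((orbits φ hs hφ).map f).hom.hom (orbitMk x) : OrbitSet φ Y) = orbitMk (f.hom.hom x) :=
  rfl

/-- `φ_*` carries single orbits to single orbits: it preserves connected objects, so it restricts to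
`B^temp(Π₁)⁰ → B^temp(Π₂)⁰` (FrdII Ex. 1.3 (ii), p. 11). [cite: MochizukiFrdII2008, Ex 1.3 (ii) p.11] -/
theorem orbits_isConnectedObj (X : BTemp G₁) (hX : IsConnectedObj X) :
    IsConnectedObj ((orbits φ hs hφ).obj X) := by
  obtain ⟨x₀⟩ := BTempConnected.nonempty_of_isConnectedObj X hX
  refine BTempConnected.isConnectedObj_of_transitive _ (orbitMk x₀ : OrbitSet φ X) fun q => ?_
  induction q using Quotient.ind with
  | _ x =>
    obtain ⟨g₁, hg₁⟩ := BTempConnected.exists_ρ_eq_of_isConnectedObj X hX x₀ x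
    refine ⟨φ g₁, ?_⟩
    change (orbitObj φ hs hφ X).obj.ρ (φ g₁) (orbitMk x₀) = orbitMk x
    rw [orbitObj_ρ_mk, hg₁]

variable (hc : Continuous φ)

/-- The bijection `Hom_{Π₂}(E/Ker(φ), F) ≃ Hom_{Π₁}(E, F|_{Π₁})`: a `Π₁`-map to a pulled-back `Π₂`-set is
constant on `Ker(φ)`-orbits, hence factors uniquely through `E/Ker(φ)` (FrdII Ex. 1.3 (ii), p. 11, "one
verifies immediately"). [cite: MochizukiFrdII2008, Ex 1.3 (ii) p.11] -/
noncomputable def orbitsHomEquiv (X : BTemp G₁) (Y : BTemp G₂) :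
    ((orbits φ hs hφ).obj X ⟶ Y) ≃ (X ⟶ (BTemp.res ⟨φ, hc⟩).obj Y) where
  toFun u := ObjectProperty.homMk
    { hom := TypeCat.ofHom fun x => (u.hom.hom (orbitMk x) : Y.obj.V)
      comm := fun g₁ => by
        apply ConcreteCategory.hom_ext
        intro x
        change (u.hom.hom (orbitMk (X.obj.ρ g₁ x)) : Y.obj.V) = Y.obj.ρ (φ g₁) (u.hom.hom (orbitMk x))
        rw [← orbitObj_ρ_mk φ hs hφ]
        exact BTempConnected.hom_ρ u (φ g₁) (orbitMk x) }
  invFun v := ObjectProperty.homMk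
    { hom := TypeCat.ofHom (orbitLift φ hc v)
      comm := fun g₂ => by
        apply ConcreteCategory.hom_ext
        intro q
        induction q using Quotient.ind with
        | _ x =>
          change orbitLift φ hc v ((orbitObj φ hs hφ X).obj.ρ g₂ (orbitMk x)) =
            Y.obj.ρ g₂ (orbitLift φ hc v (orbitMk x))
          rw [orbitObj_ρ_mk', orbitLift_mk, orbitLift_mk]
          have e := BTempConnected.hom_ρ v (Function.surjInv hs g₂) x
          change (v.hom.hom (X.obj.ρ (Function.surjInv hs g₂) x) : Y.obj.V) =
            Y.obj.ρ (φ (Function.surjInv hs g₂)) (v.hom.hom x) at e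
          rw [e, Function.surjInv_eq hs] }
  left_inv u := by
    apply BTempConnected.hom_ext_apply
    intro q
    induction q using Quotient.ind with
    | _ x => rfl
  right_inv v := by
    apply BTempConnected.hom_ext_apply
    intro x
    rfl

/-- "`φ_*` is left adjoint to the pull-back functor" (FrdII Ex. 1.3 (ii), p. 11), on all of `B^temp`:
`orbits φ ⊣ BTemp.res φ`. [cite: MochizukiFrdII2008, Ex 1.3 (ii) p.11] -/
noncomputable def orbitsAdjunction : orbits φ hs hφ ⊣ BTemp.res ⟨φ, hc⟩ :=
  Adjunction.mkOfHomEquiv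
    { homEquiv := fun X Y => orbitsHomEquiv φ hs hφ hc X Y
      homEquiv_naturality_left_symm := fun {X' X Y} f g => by
        apply BTempConnected.hom_ext_apply
        intro q
        induction q using Quotient.ind with
        | _ x => rfl
      homEquiv_naturality_right := fun {X Y Y'} f g => by
        apply BTempConnected.hom_ext_apply
        intro x
        rfl }

end Functor

/-! ### Restriction to the connected objects: `φ_* : B^temp(Π₁)⁰ → B^temp(Π₂)⁰` -/

section Connected

variable [TopologicalSpace G₂]

/-- The pull-back functor `B^temp(Π₂) → B^temp(Π₁)` along a surjective continuous homomorphism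
`φ : Π₁ → Π₂` (L3's `BTemp.res`) carries single orbits to single orbits, i.e. preserves connected
objects; so it restricts to "the pull-back functor `B^temp(Π₂)⁰ → B^temp(Π₁)⁰`" of FrdII Ex. 1.3 (ii),
p. 11. [cite: MochizukiFrdII2008, Ex 1.3 (ii) p.11] -/
theorem res_isConnectedObj (φ : G₁ →ₜ* G₂) (hφ : Function.Surjective φ) (T : BTemp G₂)
    (hT : IsConnectedObj T) : IsConnectedObj ((BTemp.res φ).obj T) := by
  obtain ⟨x₀⟩ := BTempConnected.nonempty_of_isConnectedObj T hT
  refine BTempConnected.isConnectedObj_of_transitive ((BTemp.res φ).obj T) x₀ fun x => ?_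
  obtain ⟨g₂, hg₂⟩ := BTempConnected.exists_ρ_eq_of_isConnectedObj T hT x₀ x
  obtain ⟨g₁, rfl⟩ := hφ g₂
  exact ⟨g₁, hg₂⟩

variable (φ : G₁ →* G₂) (hs : Function.Surjective φ) (hc : Continuous φ)

/-- **Example 1.3 (ii)** (FrdII p. 11): "the pull-back functor `B^temp(Π₂)⁰ → B^temp(Π₁)⁰` [i.e., obtained
by composing the `Π₂`-action on a `Π₂`-set `F₂` with `φ` so as to obtain a `Π₁`-set `F₁`]" — L3's
`BTemp.res φ` restricted to connected objects (`φ` surjective). [cite: MochizukiFrdII2008, Ex 1.3 (ii) p.11] -/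
def pullback : ConnectedPart (BTemp G₂) ⥤ ConnectedPart (BTemp G₁) :=
  (connectedObjects (BTemp G₁)).lift ((connectedObjects (BTemp G₂)).ι ⋙ BTemp.res ⟨φ, hc⟩)
    fun T => res_isConnectedObj ⟨φ, hc⟩ hs T.obj T.property

/-- The pull-back on connected objects IS `BTemp.res φ` (it commutes with the inclusions on the nose).
[cite: MochizukiFrdII2008, Ex 1.3 (ii) p.11] -/
theorem pullback_comp_ι :
    pullback φ hs hc ⋙ (connectedObjects (BTemp G₁)).ι = (connectedObjects (BTemp G₂)).ι ⋙ BTemp.res ⟨φ, hc⟩ :=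
  rfl

variable [IsTopologicalGroup G₁] (hφ : IsOpenMap φ)

/-- **Example 1.3 (ii)** (FrdII p. 11): the functor `φ_* : B^temp(Π₁)⁰ → B^temp(Π₂)⁰`, `E ↦ E/Ker(φ)`, for
a surjective open homomorphism `φ`. [cite: MochizukiFrdII2008, Ex 1.3 (ii) p.11] -/
noncomputable def pushforward : ConnectedPart (BTemp G₁) ⥤ ConnectedPart (BTemp G₂) :=
  (connectedObjects (BTemp G₂)).lift ((connectedObjects (BTemp G₁)).ι ⋙ orbits φ hs hφ)
    fun T => orbits_isConnectedObj φ hs hφ T.obj T.property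

/-- **Example 1.3 (ii)** (FrdII p. 11): "`φ_*` is left adjoint to the pull-back functor
`B^temp(Π₂)⁰ → B^temp(Π₁)⁰`" — the adjunction `orbits ⊣ res` restricted along the (fully faithful)
inclusions of the connected objects. [cite: MochizukiFrdII2008, Ex 1.3 (ii) p.11] -/
noncomputable def pushforwardAdjunction : pushforward φ hs hφ ⊣ pullback φ hs hc :=
  (orbitsAdjunction φ hs hφ hc).restrictFullyFaithful
    (connectedObjects (BTemp G₁)).fullyFaithfulι (connectedObjects (BTemp G₂)).fullyFaithfulι
    (Iso.refl _) (Iso.refl _)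

end Connected

/-! ### The named fact -/

variable [TopologicalSpace G₂] in
/-- **[FrdII] Example 1.3 (ii)** discharged: for a surjective open homomorphism `φ : Π₁ → Π₂` of tempered
groups, the functor `φ_* : B^temp(Π₁)⁰ → B^temp(Π₂)⁰`, `E ↦ E/Ker(φ)`, is left adjoint to the pull-back
functor — the named fact `QuasiTemperoid.PushforwardFunctor` with `pushforward φ` / `pullback φ` as the
witnesses (FrdII p. 11). [cite: MochizukiFrdII2008, Ex 1.3 (ii) p.11] -/
theorem pushforwardFunctor_holds : PushforwardFunctor G₁ G₂ := by
  intro _ _ φ hφ _ _ hs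
  exact ⟨pushforward φ hs hφ.isOpenMap, pullback φ hs hφ.continuous, pullback_comp_ι φ hs hφ.continuous,
    ⟨pushforwardAdjunction φ hs hφ.continuous hφ.isOpenMap⟩⟩

variable [TopologicalSpace G₂] in
/-- `PushforwardFunctor` — `_holds` alias of `pushforwardFunctor_holds` above under the fact's exact name (appended
2026-08-28, D-0026 bookkeeping: the proof term is the existing theorem of this file; no statement,
definition or attribute is edited; no new named fact; the ledger's debt table listed the fact
unproved). [cite: MochizukiFrdII2008, Ex 1.3 (ii) p.11] -/
theorem _root_.Literature.AlgebraicGeometry.Frobenioids.QuasiTemperoid.PushforwardFunctor_holds :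
    PushforwardFunctor G₁ G₂ :=
  _root_.Literature.AlgebraicGeometry.Frobenioids.QuasiTemperoid.pushforwardFunctor_holds (G₁ := G₁) (G₂ := G₂)

end QuasiTemperoid

end Literature.AlgebraicGeometry.Frobenioids
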